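import Literature.Algebra.EuclideanLattices.KhotMachineFP
import Literature.Algebra.EuclideanLattices.KhotSVPHardnessProofs
import HarnessLib

/-!
# Khot 2005, Thm. 1.1: both named facts of the cone follow from the PCP leaf alone

Topic `Algebra/EuclideanLattices`, namespace `Literature.Algebra.EuclideanLattices`. Closing file of the
two-leaf decomposition recorded in `KhotSVPHardnessProofs.lean`: the MACHINE leaf — for every `k`,
some `F ∈ FP` computes `⟨code I, c⟩ ↦ code (Khot.khotOutputExplicit k I c)` — is now proved
(`Khot.khotOutputExplicit_mem_FP`, `KhotMachineFP.lean`), so the named facts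
`Khot2005_SAT_randReducible_gapSVP` (`KhotSVPHardness.lean`) and `gapSVP_const_isNPHardRandomized`
(`LatticeComplexity.lean`, pqc.S17) follow from the PCP leaf ALONE, in any of its three printed forms:
the gap set cover hardness `AroraEtAl1997_prop6` (Arora–Babai–Stern–Sweedyk 1997, Prop. 6), the
NP-hardness of gap label cover for every constant soundness error, or Raz's theorem as printed in
Arora–Barak 2009, Thm. 22.15. One-line corollaries; no new facts.

## References

* S. Khot, *Hardness of approximating the shortest vector problem in lattices*, J. ACM 52 (2005)
  789–808, Thm. 1.1, §7.3.
* S. Arora, L. Babai, J. Stern, Z. Sweedyk, JCSS 54 (1997), Prop. 6.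
* S. Arora, B. Barak, *Computational Complexity: A Modern Approach*, CUP 2009, Thm. 22.15, §22.8.
-/

namespace Literature.Algebra.EuclideanLattices

open _root_.Computability Literature.Computability.Complexity Literature.Computability.MetaComplexity Khot

/-- **Khot 2005, Thm. 1.1 (the named fact `Khot2005_SAT_randReducible_gapSVP`) from
`AroraEtAl1997_prop6` alone.** [cite: Khot2005, Thm. 1.1 and §7.3; AroraEtAl1997, Prop. 6 (p. 319)] -/
theorem Khot2005_SAT_randReducible_gapSVP_of_prop6 (h₁ : AroraEtAl1997_prop6) : Khot2005_SAT_randReducible_gapSVP :=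
  Khot2005_SAT_randReducible_gapSVP_of_prop6_of_FP_explicit h₁ khotOutputExplicit_mem_FP

/-- The same from the NP-hardness of gap label cover for every constant soundness error.
[cite: Khot2005, Thm. 1.1; AroraBarak2009, Thm. 22.31 (§22.8)] -/
theorem Khot2005_SAT_randReducible_gapSVP_of_isNPHard_gapLabelCover
    (h₁ : ∀ ε : ℝ, 0 < ε → ∃ W : ℕ, (gapLabelCover W ε).IsNPHard) : Khot2005_SAT_randReducible_gapSVP :=
  Khot2005_SAT_randReducible_gapSVP_of_isNPHard_gapLabelCover_of_FP_explicit h₁ khotOutputExplicit_mem_FP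

/-- The same from Raz's theorem as printed in Arora–Barak 2009, Thm. 22.15.
[cite: Khot2005, Thm. 1.1; AroraBarak2009, Thm. 22.15 (p. 473)] -/
theorem Khot2005_SAT_randReducible_gapSVP_of_raz
    (h₁ : ∃ c : ℕ, 1 < c ∧ ∀ t : ℕ, 1 < t → (gapLabelCover (2 ^ (c * t)) (1 / 2 ^ t)).IsNPHard) :
    Khot2005_SAT_randReducible_gapSVP :=
  Khot2005_SAT_randReducible_gapSVP_of_raz_of_FP_explicit h₁ khotOutputExplicit_mem_FP

/-- **pqc.S17 (`gapSVP_const_isNPHardRandomized`) from the NP-hardness of gap label cover alone.**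
[cite: Khot2005, Thm. 1.1; AroraBarak2009, Thm. 22.31 (§22.8)] -/
theorem gapSVP_const_isNPHardRandomized_of_isNPHard_gapLabelCover
    (h₁ : ∀ ε : ℝ, 0 < ε → ∃ W : ℕ, (gapLabelCover W ε).IsNPHard) : gapSVP_const_isNPHardRandomized :=
  gapSVP_const_isNPHardRandomized_of_isNPHard_gapLabelCover_of_FP_explicit h₁ khotOutputExplicit_mem_FP

/-- **pqc.S17 from Raz's theorem (Arora–Barak 2009, Thm. 22.15) alone.**
[cite: Khot2005, Thm. 1.1; AroraBarak2009, Thm. 22.15 (p. 473)] -/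
theorem gapSVP_const_isNPHardRandomized_of_raz
    (h₁ : ∃ c : ℕ, 1 < c ∧ ∀ t : ℕ, 1 < t → (gapLabelCover (2 ^ (c * t)) (1 / 2 ^ t)).IsNPHard) :
    gapSVP_const_isNPHardRandomized :=
  gapSVP_const_isNPHardRandomized_of_prop6 (AroraEtAl1997_prop6_of_raz h₁)

/-- Pointwise form: under `AroraEtAl1997_prop6`, ONE randomised reduction `ofLanguage SAT → GapSVP_{γ₀}`
for every constant `γ₀ ≥ 1`. [cite: Khot2005, Thm. 1.1 and §7.3] -/
theorem promiseRandReducible_SAT_gapSVP_of_prop6 (h₁ : AroraEtAl1997_prop6) {γ₀ : ℝ} (hγ₀ : 1 ≤ γ₀) :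
    PromiseRandReducible (PromiseProblem.ofLanguage SAT) (gapSVPPromise fun _ => γ₀) := by
  obtain ⟨k, hk⟩ := exists_levels γ₀
  obtain ⟨F, hF, hFI⟩ := khotOutputExplicit_mem_FP k
  exact promiseRandReducible_SAT_gapSVP_of_prop6_of_FP_explicit h₁ hγ₀ hk hF hFI

end Literature.Algebra.EuclideanLattices
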